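import Summits.HubbardSuperconductivity.HubbardSuperconductivity.Theorems.ThermalWedgeTwSeededRungSectorGibbs
import Literature.MathematicalPhysics.QuantumLattice.DWaveSource

/-!
# Crux `TwSeededEnsembleEquivalence` (stmt-HubbardSuperconductivity-1698), line `exposed-density-duality`
# (thermal member, skeleton v12) — stub `stub_thermalWalk`: the THERMAL ONE-PARTICLE WALK

For the seeded grand-canonical torus `K = hubbardTorusWith 2 L 1 U 0 − (g/L²)P_L` and its sector
weights `W_L(N) = Σ_{|s| = N} Re (e^{−βK})_{ss}` (`β ≥ 0`): `W_L(N) ≤ ((2L²−N+1)/N) e^{βR/N} W_L(N−1)`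
(`1 ≤ N ≤ 2L²`) and `W_L(N) ≤ ((N+1)/(2L²−N)) e^{βR/(2L²−N)} W_L(N+1)` (`N + 1 ≤ 2L²`), GIVEN the
Jensen trace inequality and the restricted Loewner monotonicity of `stub_sectorTraceToolkit`
(hypotheses `hJ`, `hM`) and a bound `R` on the commutator sums of `stub_commutatorSums` (`hR₁`, `hR₂`).
Both bounds are instances of one abstract step `thermalWalk_step` (Kraus family `V_o = m^{−1/2} c_o P`,
`Σ_o V_oᴴ K V_o = P K P + m⁻¹ P R̂ P` with `R̂ = Σ_o c_o†[K, c_o]` Hermitian of norm `≤ R`), applied to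
`c_o` (down, `m = N`, `Σ_o c_o†c_o = N̂`) and to `c_o†` (up, `m = 2L² − N`, `Σ_o c_o c_o† = 2L² − N̂`).
Bratteli–Robinson II §5.2.2 (CAR), §5.3.1 (Gibbs states); finite-dimensional folklore.
-/

set_option linter.dupNamespace false

namespace Summit.HubbardSuperconductivity.HubbardSuperconductivity.Theorems.TwSeededEnsembleEquivalence.ThermalDuality

open Matrix Finset Literature.MathematicalPhysics.QuantumLattice
open scoped ComplexOrder Matrix.Norms.L2Operator

noncomputable section

section Generic

variable {n : Type*} [Fintype n] [DecidableEq n]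

/-- `R·1 − H ≥ 0` for a Hermitian `H` with `‖H‖ ≤ R` (Loewner order, L²-operator norm). [folklore] -/
private theorem posSemidef_smul_one_sub_of_norm_le {H : Matrix n n ℂ} (hH : H.IsHermitian) {R : ℝ}
    (hR : ‖H‖ ≤ R) : ((R : ℂ) • (1 : Matrix n n ℂ) - H).PosSemidef := by
  have hh : ((R : ℂ) • (1 : Matrix n n ℂ) - H).IsHermitian :=
    (isHermitian_real_smul isHermitian_one _).sub hH
  refine PosSemidef.of_dotProduct_mulVec_nonneg hh fun x =>
    Complex.nonneg_iff.2 ⟨?_, (hh.im_star_dotProduct_mulVec_self x).symm⟩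
  rw [sub_mulVec, dotProduct_sub, smul_mulVec, one_mulVec, dotProduct_smul, smul_eq_mul,
    Complex.sub_re, Complex.re_ofReal_mul]
  have h3 : 0 ≤ (star x ⬝ᵥ x).re := (Complex.nonneg_iff.1 (dotProduct_star_self_nonneg x)).1
  linarith [norm_star_dotProduct_mulVec_le H x, Complex.abs_re_le_norm (star x ⬝ᵥ H *ᵥ x),
    le_abs_self ((star x ⬝ᵥ H *ᵥ x).re), mul_le_mul_of_nonneg_right hR h3]

/-- **The abstract walk step.** `P, Q` Hermitian idempotents, `K` Hermitian with `[K, P] = 0`, `c_o` a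
finite family with adjoints `c'_o` such that `c_o P = Q c_o`, `P (Σ_o c'_o c_o) = m P` (`m > 0`),
`Q (Σ_o c_o c'_o) = m' Q`, `[K, Σ_o c'_o c_o] = 0` and `‖Σ_o c'_o [K, c_o]‖ ≤ R`. If the Jensen trace
inequality (`hJ`) and the restricted Loewner monotonicity (`hM`) hold for `P`, then
`Re Tr (P e^{−βK}) ≤ (m'/m) e^{βR/m} Re Tr (Q e^{−βK})` (Kraus family `V_o = m^{−1/2} c_o P`). [folklore] -/
private theorem thermalWalk_step {ι : Type*} [Fintype ι] {P Q K : Matrix n n ℂ}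
    {c c' : ι → Matrix n n ℂ} {β R m m' : ℝ}
    (hJ : ∀ (K : Matrix n n ℂ) (V : ι → Matrix n n ℂ) (β : ℝ), K.IsHermitian →
      ∑ o, (V o)ᴴ * V o = P →
      ((P * gibbsWeight β (∑ o, (V o)ᴴ * K * V o)).trace).re ≤
        ∑ o, (((V o)ᴴ * gibbsWeight β K * V o).trace).re)
    (hM : ∀ (K X : Matrix n n ℂ) (r β : ℝ), K.IsHermitian → X.IsHermitian → 0 ≤ β →
      K * P = P * K → X = P * X * P → (P * K * P + (r : ℂ) • P - X).PosSemidef →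
      Real.exp (-(β * r)) * ((P * gibbsWeight β K).trace).re ≤ ((P * gibbsWeight β X).trace).re)
    (hβ : 0 ≤ β) (hm : 0 < m) (hK : K.IsHermitian) (hP : P.IsHermitian) (hPP : P * P = P)
    (hQ : Q.IsHermitian) (hQQ : Q * Q = Q) (hcc' : ∀ o, (c o)ᴴ = c' o) (hKP : K * P = P * K)
    (hKD : K * (∑ o, c' o * c o) = (∑ o, c' o * c o) * K)
    (hD₁ : P * (∑ o, c' o * c o) = (m : ℂ) • P) (hshift : ∀ o, c o * P = Q * c o)
    (hD₂ : Q * (∑ o, c o * c' o) = (m' : ℂ) • Q)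
    (hR : ‖∑ o, c' o * (K * c o - c o * K)‖ ≤ R) :
    ((P * gibbsWeight β K).trace).re ≤
      m' / m * Real.exp (β * R / m) * ((Q * gibbsWeight β K).trace).re := by
  -- the Kraus family `V_o = a c_o P`, `a² = t = m⁻¹`
  set t : ℝ := m⁻¹ with ht
  have ht0 : 0 ≤ t := inv_nonneg.2 hm.le
  set a : ℝ := Real.sqrt t
  have haa : (a : ℂ) * a = t := by rw [← Complex.ofReal_mul, Real.mul_self_sqrt ht0]
  have htm : ((t * m : ℝ) : ℂ) = 1 := by rw [ht, inv_mul_cancel₀ hm.ne', Complex.ofReal_one]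
  have hc'c : ∀ o, (c' o)ᴴ = c o := fun o => by rw [← hcc', conjTranspose_conjTranspose]
  have hVct : ∀ o, ((a : ℂ) • (c o * P))ᴴ = (a : ℂ) • (P * c' o) := fun o => by
    rw [conjTranspose_smul, conjTranspose_mul, hcc', hP.eq, Complex.star_def, Complex.conj_ofReal]
  have hPc' : ∀ o, P * c' o = c' o * Q := fun o => by
    have h := congrArg conjTranspose (hshift o)
    rwa [conjTranspose_mul, conjTranspose_mul, hcc', hP.eq, hQ.eq] at h
  have hconj : ∀ Y : Matrix n n ℂ, ∑ o, ((a : ℂ) • (c o * P))ᴴ * Y * ((a : ℂ) • (c o * P)) =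
      (t : ℂ) • (P * (∑ o, c' o * Y * c o) * P) := fun Y => by
    rw [Finset.mul_sum, Finset.sum_mul, Finset.smul_sum]
    refine Finset.sum_congr rfl fun o _ => ?_
    rw [hVct, Matrix.smul_mul, Matrix.smul_mul, Matrix.mul_smul, smul_smul, haa]
    simp only [Matrix.mul_assoc]
  have hKraus : ∑ o, ((a : ℂ) • (c o * P))ᴴ * ((a : ℂ) • (c o * P)) = P := by
    have h := hconj 1
    simp only [Matrix.mul_one] at h
    rw [h, hD₁, Matrix.smul_mul, hPP, smul_smul, ← Complex.ofReal_mul, htm, one_smul]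
  -- the commutator sum `R̂` (Hermitian) and the compressed Hamiltonian `A = Σ_o V_oᴴ K V_o`
  set Rh : Matrix n n ℂ := ∑ o, c' o * (K * c o - c o * K) with hRh_def
  set A : Matrix n n ℂ := ∑ o, ((a : ℂ) • (c o * P))ᴴ * K * ((a : ℂ) • (c o * P))
  have hsplit : ∑ o, c' o * K * c o = Rh + (∑ o, c' o * c o) * K := by
    rw [hRh_def, Finset.sum_mul, ← Finset.sum_add_distrib]
    refine Finset.sum_congr rfl fun o _ => ?_
    rw [Matrix.mul_sub, Matrix.mul_assoc, Matrix.mul_assoc, sub_add_cancel]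
  have hDh : (∑ o, c' o * c o).IsHermitian := by
    refine isSelfAdjoint_sum _ fun o _ => ?_
    show (c' o * c o)ᴴ = c' o * c o
    rw [conjTranspose_mul, hc'c, hcc']
  have hRhh : Rh.IsHermitian := by
    have h1 : (∑ o, c' o * K * c o).IsHermitian := by
      refine isSelfAdjoint_sum _ fun o _ => ?_
      have h := isHermitian_conjTranspose_mul_mul (c o) hK
      rwa [hcc'] at h
    have h2 : ((∑ o, c' o * c o) * K).IsHermitian := by
      show ((∑ o, c' o * c o) * K)ᴴ = (∑ o, c' o * c o) * K
      rw [conjTranspose_mul, hK.eq, hDh.eq, hKD]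
    rw [eq_sub_of_add_eq hsplit.symm]
    exact h1.sub h2
  have hA₁ : A = (t : ℂ) • (P * (∑ o, c' o * K * c o) * P) := hconj K
  have hA₂ : A = (t : ℂ) • (P * Rh * P) + P * K * P := by
    rw [hA₁, hsplit, Matrix.mul_add, Matrix.add_mul, smul_add]
    congr 1
    rw [← Matrix.mul_assoc P _ K, hD₁, Matrix.smul_mul, Matrix.smul_mul, smul_smul,
      ← Complex.ofReal_mul, htm, one_smul]
  have hPP' : ∀ X : Matrix n n ℂ, P * (P * X) = P * X := fun X => by rw [← Matrix.mul_assoc, hPP]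
  have hA₃ : A = P * A * P := by
    rw [hA₁]
    simp only [Matrix.mul_smul, Matrix.smul_mul, Matrix.mul_assoc, hPP, hPP']
  have hAh : A.IsHermitian := isSelfAdjoint_sum _ fun o _ => isHermitian_conjTranspose_mul_mul _ hK
  have hpsd : (P * K * P + ((t * R : ℝ) : ℂ) • P - A).PosSemidef := by
    have h1 := ((posSemidef_smul_one_sub_of_norm_le hRhh hR).mul_mul_conjTranspose_same P).smul
      (Complex.zero_le_real.2 ht0)
    rw [hP.eq] at h1
    convert h1 using 1
    rw [hA₂, Matrix.mul_sub, Matrix.sub_mul, Matrix.mul_smul, Matrix.mul_one, Matrix.smul_mul, hPP,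
      smul_sub, smul_smul, ← Complex.ofReal_mul]
    abel
  -- Loewner monotonicity, then Jensen, whose right-hand side is `t m' Re Tr (Q e^{−βK})`
  have h1 := hM K A (t * R) β hK hAh hβ hKP hA₃ hpsd
  have h2 := hJ K (fun o => (a : ℂ) • (c o * P)) β hK hKraus
  beta_reduce at h2
  have hVV : ∑ o, (a : ℂ) • (c o * P) * ((a : ℂ) • (c o * P))ᴴ = ((t * m' : ℝ) : ℂ) • Q := by
    have h : ∀ o, (a : ℂ) • (c o * P) * ((a : ℂ) • (c o * P))ᴴ = (t : ℂ) • (Q * (c o * c' o) * Q) :=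
      fun o => by
        rw [hVct, Matrix.smul_mul, Matrix.mul_smul, smul_smul, haa, hshift, hPc']
        simp only [Matrix.mul_assoc]
    rw [Finset.sum_congr rfl fun o _ => h o, ← Finset.smul_sum, ← Finset.sum_mul, ← Finset.mul_sum,
      hD₂, Matrix.smul_mul, hQQ, smul_smul, ← Complex.ofReal_mul]
  have h3 : ∑ o, ((((a : ℂ) • (c o * P))ᴴ * gibbsWeight β K * ((a : ℂ) • (c o * P))).trace).re =
      t * m' * ((Q * gibbsWeight β K).trace).re := by
    rw [← Complex.re_sum, Finset.sum_congr rfl fun o _ => Matrix.trace_mul_cycle _ _ _,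
      ← Matrix.trace_sum, ← Finset.sum_mul, hVV, Matrix.smul_mul, Matrix.trace_smul, smul_eq_mul,
      Complex.re_ofReal_mul]
  have h4 : Real.exp (-(β * (t * R))) * ((P * gibbsWeight β K).trace).re ≤
      t * m' * ((Q * gibbsWeight β K).trace).re := h1.trans (h2.trans_eq h3)
  rw [show -(β * (t * R)) = -(β * R / m) by rw [ht]; ring, Real.exp_neg,
    inv_mul_le_iff₀ (Real.exp_pos _)] at h4
  calc ((P * gibbsWeight β K).trace).re ≤ _ := h4
    _ = m' / m * Real.exp (β * R / m) * ((Q * gibbsWeight β K).trace).re := by rw [ht]; ring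

end Generic

section FockSpace

variable {ι : Type*} [LinearOrder ι] [Fintype ι] [DecidableEq ι]

omit [LinearOrder ι] in
/-- `Re tr (P_N G) = Σ_{|s| = N} Re G_{ss}` for the indicator `P_N = diagonal [|s| = N]` of the `N`-particle
sector (the explicit `[DecidableEq ι]` makes these statements unify with the registered one). [folklore] -/
private theorem re_trace_sectorProj_mul (N : ℕ) (G : Matrix (Finset ι) (Finset ι) ℂ) :
    ((diagonal (fun s : Finset ι => if s.card = N then (1 : ℂ) else 0) * G).trace).re =
      ∑ s ∈ (Finset.univ.filter fun s : Finset ι => s.card = N), (G s s).re := by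
  rw [Matrix.trace, Complex.re_sum, Finset.sum_filter]
  refine Finset.sum_congr rfl fun s _ => ?_
  simp only [Matrix.diag_apply, diagonal_mul, ite_mul, one_mul, zero_mul]
  split_ifs <;> simp

omit [LinearOrder ι] in
/-- `P_N² = P_N`. [folklore] -/
private theorem sectorProj_mul_self (N : ℕ) :
    diagonal (fun s : Finset ι => if s.card = N then (1 : ℂ) else 0) *
        diagonal (fun s : Finset ι => if s.card = N then (1 : ℂ) else 0) =
      diagonal (fun s : Finset ι => if s.card = N then (1 : ℂ) else 0) := by
  rw [diagonal_mul_diagonal]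
  congr 1
  funext s
  split_ifs <;> simp

omit [LinearOrder ι] [Fintype ι] in
/-- `P_N` is Hermitian. [folklore] -/
private theorem sectorProj_isHermitian (N : ℕ) :
    (diagonal (fun s : Finset ι => if s.card = N then (1 : ℂ) else 0)).IsHermitian :=
  isHermitian_diagonal_of_self_adjoint _ (funext fun s => by
    rw [Pi.star_apply]
    split_ifs <;> simp)

omit [LinearOrder ι] in
/-- `P_N · diagonal (f |s|) = f N · P_N`. [folklore] -/
private theorem sectorProj_mul_diagonal_card (N : ℕ) (f : ℕ → ℂ) :
    diagonal (fun s : Finset ι => if s.card = N then (1 : ℂ) else 0) *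
        diagonal (fun s : Finset ι => f s.card) =
      f N • diagonal (fun s : Finset ι => if s.card = N then (1 : ℂ) else 0) := by
  rw [diagonal_mul_diagonal, ← diagonal_smul]
  congr 1
  funext s
  simp only [Pi.smul_apply, smul_eq_mul]
  by_cases h : s.card = N <;> simp [h]

omit [Fintype ι] [DecidableEq ι] in
/-- `⟨s| c_i |t⟩ ≠ 0` forces `|t| = |s| + 1`. Bratteli–Robinson II §5.2.2. [folklore] -/
private theorem card_eq_of_annihilation_ne_zero {i : ι} {s t : Finset ι}
    (h : annihilation i s t ≠ 0) : t.card = s.card + 1 := by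
  rw [annihilation_apply] at h
  split_ifs at h with hc
  · rw [hc.2, card_insert_of_notMem hc.1]
  · exact absurd rfl h

/-- `c_i` lowers the particle number by one: `c_i P_{M+1} = P_M c_i`. Bratteli–Robinson II §5.2.2.
[folklore] -/
private theorem annihilation_mul_sectorProj (i : ι) (M : ℕ) :
    annihilation i * diagonal (fun s : Finset ι => if s.card = M + 1 then (1 : ℂ) else 0) =
      diagonal (fun s : Finset ι => if s.card = M then (1 : ℂ) else 0) * annihilation i := by
  ext s t
  rw [mul_diagonal, diagonal_mul]
  by_cases h : annihilation i s t = 0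
  · rw [h, zero_mul, mul_zero]
  · rw [card_eq_of_annihilation_ne_zero h]
    by_cases hs : s.card = M <;> simp [hs]

/-- `c†_i` raises the particle number by one: `c†_i P_M = P_{M+1} c†_i` (adjoint of the previous).
[folklore] -/
private theorem creation_mul_sectorProj (i : ι) (M : ℕ) :
    creation i * diagonal (fun s : Finset ι => if s.card = M then (1 : ℂ) else 0) =
      diagonal (fun s : Finset ι => if s.card = M + 1 then (1 : ℂ) else 0) * creation i := by
  have h := congrArg conjTranspose (annihilation_mul_sectorProj i M)
  rw [conjTranspose_mul, conjTranspose_mul, annihilation_conjTranspose,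
    (sectorProj_isHermitian M).eq, (sectorProj_isHermitian (M + 1)).eq] at h
  exact h.symm

/-- `Σ_i c†_i c_i = N̂ = diagonal |s|`. Tasaki (2020) §9.2. [folklore] -/
private theorem sum_creation_mul_annihilation :
    ∑ i : ι, creation i * annihilation i = diagonal (fun s : Finset ι => (s.card : ℂ)) := by
  change totalNumberOp = _
  -- the two sides carry different (propositionally equal) `DecidableEq` instances
  convert totalNumberOp_eq_diagonal (ι := ι)

/-- `Σ_i c_i c†_i = |ι| − N̂` (CAR). Bratteli–Robinson II §5.2.2. [folklore] -/
private theorem sum_annihilation_mul_creation :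
    ∑ i : ι, annihilation i * creation i =
      diagonal (fun s : Finset ι => ((Fintype.card ι : ℂ) - s.card)) := by
  simp only [annihilation_mul_creation, ite_true]
  rw [Finset.sum_sub_distrib, sum_creation_mul_annihilation, Finset.sum_const, Finset.card_univ]
  ext s t
  simp only [Matrix.sub_apply, Matrix.smul_apply, Matrix.one_apply, diagonal_apply]
  split_ifs <;> simp

end FockSpace

section Seeded

variable (L : ℕ) [NeZero L]

-- adapted from …Theorems.ThermalWedgeTwSeededEnsembleEquivalenceSectorWeightBasics (`diagonal_card_mul_seededGC`)
/-- `K_L(0)` commutes with every diagonal function of the particle number `|s|` (it is block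
diagonal in `(N↑, N↓)`, `tw_preservesSectors_seededGC`). [folklore] -/
private theorem seededGC_mul_diagonal_card (U g : ℝ) (f : ℕ → ℂ) :
    (hubbardTorusWith 2 L 1 U 0 - ((g / (L : ℝ) ^ 2 : ℝ) : ℂ) •
          ((pairField dWaveFormFactor L)ᴴ * pairField dWaveFormFactor L)) *
        diagonal (fun s : Finset (Orb (FermionTorus 2 L)) => f s.card) =
      diagonal (fun s : Finset (Orb (FermionTorus 2 L)) => f s.card) *
        (hubbardTorusWith 2 L 1 U 0 - ((g / (L : ℝ) ^ 2 : ℝ) : ℂ) •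
          ((pairField dWaveFormFactor L)ᴴ * pairField dWaveFormFactor L)) := by
  ext s s'
  rw [diagonal_mul, mul_diagonal]
  by_cases h : (hubbardTorusWith 2 L 1 U 0 - ((g / (L : ℝ) ^ 2 : ℝ) : ℂ) •
      ((pairField dWaveFormFactor L)ᴴ * pairField dWaveFormFactor L)) s s' = 0
  · rw [h, mul_zero, zero_mul]
  · obtain ⟨h1, h2⟩ := tw_preservesSectors_seededGC L U 0 g s s' h
    rw [card_eq_upPart_add_downPart s, card_eq_upPart_add_downPart s', h1, h2, mul_comm]

end Seeded

/-! ## The stub -/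

/-- STUB D — THE THERMAL ONE-PARTICLE WALK. For the seeded torus at `μ = 0`, `β ≥ 0`, given the two abstract trace
inequalities of `stub_sectorTraceToolkit` (hypotheses `hJ`, `hM`) and bounds `R` on the two commutator sums of
`stub_commutatorSums` (hypotheses `hR₁`, `hR₂`): `W_L(N) ≤ ((2L² − N + 1)/N)·e^{βR/N}·W_L(N − 1)` (`1 ≤ N ≤ 2L²`) and
`W_L(N) ≤ ((N + 1)/(2L² − N))·e^{βR/(2L²−N)}·W_L(N + 1)` (`N < 2L²`). Proof (down-step): Kraus family
`V_o = N^{−1/2} c_o P_N` has `Σ_o V_oᴴV_o = P_N` (`Σ_o c_o†c_o = N̂`), `A = Σ_o V_oᴴ K V_o = P_N K P_N + N⁻¹ P_N R P_N`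
with `R = Σ_o c_o†[K, c_o]`, so `A ≤ P_N K P_N + (‖R‖/N) P_N` and `hM` gives `e^{−β‖R‖/N} W_L(N) ≤ Re Tr P_N e^{−βA}`,
while `hJ` gives `Re Tr P_N e^{−βA} ≤ N⁻¹ Re Tr (e^{−βK} Σ_o c_o P_N c_o†) = ((2L² − N + 1)/N) W_L(N−1)`
(`c_o P_N = P_{N−1} c_o`, `Σ_o c_o c_o† = 2L² − N̂`); the up-step is the same with `c_o†`, `Σ_o c_o c_o† = 2L² − N̂`.
[folklore] -/
theorem stub_thermalWalk :
    ∀ (L : ℕ) [NeZero L] (U g β R : ℝ), 0 ≤ β →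
      (∀ (K : Matrix (Finset (Orb (FermionTorus 2 L))) (Finset (Orb (FermionTorus 2 L))) ℂ)
        (V : Orb (FermionTorus 2 L) → Matrix (Finset (Orb (FermionTorus 2 L))) (Finset (Orb (FermionTorus 2 L))) ℂ)
        (N : ℕ) (β : ℝ), K.IsHermitian →
        ∑ o, (V o)ᴴ * V o =
          Matrix.diagonal (fun s : Finset (Orb (FermionTorus 2 L)) => if s.card = N then (1 : ℂ) else 0) →
        ((Matrix.diagonal (fun s : Finset (Orb (FermionTorus 2 L)) => if s.card = N then (1 : ℂ) else 0) *
            Matrix.gibbsWeight β (∑ o, (V o)ᴴ * K * V o)).trace).re ≤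
          ∑ o, (((V o)ᴴ * Matrix.gibbsWeight β K * V o).trace).re) →
      (∀ (K X : Matrix (Finset (Orb (FermionTorus 2 L))) (Finset (Orb (FermionTorus 2 L))) ℂ)
        (N : ℕ) (r β : ℝ), K.IsHermitian → X.IsHermitian → 0 ≤ β →
        K * Matrix.diagonal (fun s : Finset (Orb (FermionTorus 2 L)) => if s.card = N then (1 : ℂ) else 0) =
          Matrix.diagonal (fun s : Finset (Orb (FermionTorus 2 L)) => if s.card = N then (1 : ℂ) else 0) * K →
        X = Matrix.diagonal (fun s : Finset (Orb (FermionTorus 2 L)) => if s.card = N then (1 : ℂ) else 0) * X *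
          Matrix.diagonal (fun s : Finset (Orb (FermionTorus 2 L)) => if s.card = N then (1 : ℂ) else 0) →
        (Matrix.diagonal (fun s : Finset (Orb (FermionTorus 2 L)) => if s.card = N then (1 : ℂ) else 0) * K *
              Matrix.diagonal (fun s : Finset (Orb (FermionTorus 2 L)) => if s.card = N then (1 : ℂ) else 0) +
            (r : ℂ) • Matrix.diagonal (fun s : Finset (Orb (FermionTorus 2 L)) => if s.card = N then (1 : ℂ) else 0) -
            X).PosSemidef →
        Real.exp (-(β * r)) *
            ((Matrix.diagonal (fun s : Finset (Orb (FermionTorus 2 L)) => if s.card = N then (1 : ℂ) else 0) *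
              Matrix.gibbsWeight β K).trace).re ≤
          ((Matrix.diagonal (fun s : Finset (Orb (FermionTorus 2 L)) => if s.card = N then (1 : ℂ) else 0) *
              Matrix.gibbsWeight β X).trace).re) →
      ‖∑ o : Orb (FermionTorus 2 L), creation o *
          ((hubbardTorusWith 2 L 1 U 0 - ((g / (L : ℝ) ^ 2 : ℝ) : ℂ) •
              ((pairField dWaveFormFactor L)ᴴ * pairField dWaveFormFactor L)) * annihilation o -
            annihilation o * (hubbardTorusWith 2 L 1 U 0 - ((g / (L : ℝ) ^ 2 : ℝ) : ℂ) •
              ((pairField dWaveFormFactor L)ᴴ * pairField dWaveFormFactor L)))‖ ≤ R →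
      ‖∑ o : Orb (FermionTorus 2 L), annihilation o *
          ((hubbardTorusWith 2 L 1 U 0 - ((g / (L : ℝ) ^ 2 : ℝ) : ℂ) •
              ((pairField dWaveFormFactor L)ᴴ * pairField dWaveFormFactor L)) * creation o -
            creation o * (hubbardTorusWith 2 L 1 U 0 - ((g / (L : ℝ) ^ 2 : ℝ) : ℂ) •
              ((pairField dWaveFormFactor L)ᴴ * pairField dWaveFormFactor L)))‖ ≤ R →
      ∀ N : ℕ,
        (1 ≤ N → N ≤ 2 * L ^ 2 →
          ∑ s ∈ (Finset.univ.filter fun s : Finset (Orb (FermionTorus 2 L)) => s.card = N),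
              (Matrix.gibbsWeight β (hubbardTorusWith 2 L 1 U 0 - ((g / (L : ℝ) ^ 2 : ℝ) : ℂ) •
                ((pairField dWaveFormFactor L)ᴴ * pairField dWaveFormFactor L)) s s).re ≤
            ((2 * (L : ℝ) ^ 2 - N + 1) / N) * Real.exp (β * R / N) *
              ∑ s ∈ (Finset.univ.filter fun s : Finset (Orb (FermionTorus 2 L)) => s.card = N - 1),
                (Matrix.gibbsWeight β (hubbardTorusWith 2 L 1 U 0 - ((g / (L : ℝ) ^ 2 : ℝ) : ℂ) •
                  ((pairField dWaveFormFactor L)ᴴ * pairField dWaveFormFactor L)) s s).re) ∧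
        (N + 1 ≤ 2 * L ^ 2 →
          ∑ s ∈ (Finset.univ.filter fun s : Finset (Orb (FermionTorus 2 L)) => s.card = N),
              (Matrix.gibbsWeight β (hubbardTorusWith 2 L 1 U 0 - ((g / (L : ℝ) ^ 2 : ℝ) : ℂ) •
                ((pairField dWaveFormFactor L)ᴴ * pairField dWaveFormFactor L)) s s).re ≤
            ((N + 1) / (2 * (L : ℝ) ^ 2 - N)) * Real.exp (β * R / (2 * (L : ℝ) ^ 2 - N)) *
              ∑ s ∈ (Finset.univ.filter fun s : Finset (Orb (FermionTorus 2 L)) => s.card = N + 1),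
                (Matrix.gibbsWeight β (hubbardTorusWith 2 L 1 U 0 - ((g / (L : ℝ) ^ 2 : ℝ) : ℂ) •
                  ((pairField dWaveFormFactor L)ᴴ * pairField dWaveFormFactor L)) s s).re) := by
  intro L _ U g β R hβ hJ hM hR₁ hR₂ N
  set K₀ := hubbardTorusWith 2 L 1 U 0 - ((g / (L : ℝ) ^ 2 : ℝ) : ℂ) •
    ((pairField dWaveFormFactor L)ᴴ * pairField dWaveFormFactor L)
  have hK : K₀.IsHermitian := tw_isHermitian_seededGC L U 0 g
  have hKd : ∀ f : ℕ → ℂ, K₀ * diagonal (fun s : Finset (Orb (FermionTorus 2 L)) => f s.card) =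
      diagonal (fun s : Finset (Orb (FermionTorus 2 L)) => f s.card) * K₀ :=
    seededGC_mul_diagonal_card L U g
  have hcard : (Fintype.card (Orb (FermionTorus 2 L)) : ℂ) = 2 * (L : ℂ) ^ 2 := by
    rw [card_orb]
    simp [FermionTorus, Fintype.card_lex]
  have hKn : K₀ * (∑ o, creation o * annihilation o) = (∑ o, creation o * annihilation o) * K₀ := by
    rw [sum_creation_mul_annihilation]
    exact hKd fun k => (k : ℂ)
  have hKh : K₀ * (∑ o, annihilation o * creation o) = (∑ o, annihilation o * creation o) * K₀ := by
    rw [sum_annihilation_mul_creation]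
    exact hKd fun k => (Fintype.card (Orb (FermionTorus 2 L)) : ℂ) - k
  constructor
  · -- the DOWN-step: `c_o` lowers `N = M + 1` to `M`; `m = M + 1`, `m' = 2L² − M`
    intro h1N hN2
    obtain ⟨M, rfl⟩ : ∃ M, N = M + 1 := ⟨N - 1, (Nat.sub_add_cancel h1N).symm⟩
    rw [Nat.add_sub_cancel]
    have hw := thermalWalk_step (m := ((M + 1 : ℕ) : ℝ)) (m' := 2 * (L : ℝ) ^ 2 - ((M + 1 : ℕ) : ℝ) + 1)
      (fun K V β hK hV => hJ K V (M + 1) β hK hV) (fun K X r β => hM K X (M + 1) r β) hβ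
      (by positivity) hK (sectorProj_isHermitian _) (sectorProj_mul_self _) (sectorProj_isHermitian _)
      (sectorProj_mul_self _) annihilation_conjTranspose (hKd fun k => if k = M + 1 then 1 else 0) hKn
      (by rw [sum_creation_mul_annihilation, sectorProj_mul_diagonal_card, Complex.ofReal_natCast])
      (fun o => annihilation_mul_sectorProj o M)
      (by
        rw [sum_annihilation_mul_creation, sectorProj_mul_diagonal_card M fun k =>
          (Fintype.card (Orb (FermionTorus 2 L)) : ℂ) - k, hcard]
        congr 1
        push_cast
        ring)
      hR₁
    simpa only [re_trace_sectorProj_mul] using hw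
  · -- the UP-step: `c†_o` raises `N` to `N + 1`; `m = 2L² − N`, `m' = N + 1`
    intro hN1
    have hw := thermalWalk_step (m := 2 * (L : ℝ) ^ 2 - N) (m' := (N : ℝ) + 1)
      (fun K V β hK hV => hJ K V N β hK hV) (fun K X r β => hM K X N r β) hβ
      (sub_pos.2 (by exact_mod_cast Nat.lt_of_succ_le hN1)) hK (sectorProj_isHermitian _)
      (sectorProj_mul_self _) (sectorProj_isHermitian _)
      (sectorProj_mul_self _) creation_conjTranspose (hKd fun k => if k = N then 1 else 0) hKh
      (by
        rw [sum_annihilation_mul_creation, sectorProj_mul_diagonal_card N fun k =>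
          (Fintype.card (Orb (FermionTorus 2 L)) : ℂ) - k, hcard]
        congr 1
        push_cast
        ring)
      (fun o => creation_mul_sectorProj o N)
      (by
        rw [sum_creation_mul_annihilation, sectorProj_mul_diagonal_card]
        congr 1
        push_cast
        ring)
      hR₂
    simpa only [re_trace_sectorProj_mul] using hw

end

end Summit.HubbardSuperconductivity.HubbardSuperconductivity.Theorems.TwSeededEnsembleEquivalence.ThermalDuality
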